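import Literature.Analysis.FluidPDE.TypeIAncientMild
import Literature.Analysis.FluidPDE.WeakSolution
import Summits.NavierStokesRegularity.NavierStokesRegularity.Theorems.SymmetricLiouville.Negative.BlowdownStubsLoadBearing

/-!
# Crux `SymmetricLiouville` (stmt-NavierStokesRegularity-4053), negative side:
the narrowed open core `stub_rssLiouvilleOfFarField` of line `blowdown-kills-pitch` consumes the gauge

Drefute (D-0016) support lemma for the lead's cycle-2 reshape of
`Cruxes/SymmetricLiouville/Lines/blowdown_kills_pitch.lean` (route `SymmetryModuliCount`). The only stub of the
line that is not yet a theorem of the tree is the narrowed open core `stub_rssLiouvilleOfFarField`: an element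
`u` of `A_C` (`IsTypeIAncientMild C u`) annihilated by the rotated-scaling generator `∇u·(x + Ax) + u + 2t∂ₜu − Au`,
`A ≠ 0` skew, whose scale-invariant size `√(−t)‖u(t,x)‖` is `≤ ε` for `‖x‖ ≥ R(ε)√(−t)` (profile vanishing at
infinity), is `0`. Here the Oseen integral equation (the KNSS gauge) is dropped from the class and the mutant is
refuted, at EVERY Type-I constant `C > 0`, by an explicit witness, the decaying swirl `u(t, x) = C·Jx/(‖x‖² − t)`
(`J = rotJ` of the sibling `BlowdownStubsLoadBearing`, the rotation generator about the `x₂`-axis; `f0`, `e1` from `AncientLoadBearing`): jointly smooth on `t < 0`, divergence free, Type-I in time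
(constant `C`) AND in space–time (`‖u‖ ≤ 2C/(‖x‖ + √(−t))`, Pineau–Vicol's class (1.10)), backward self-similar
AND axisymmetric about the `x₂`-axis — so it satisfies the rotated-scaling clause with `A = J` exactly — with
profile `U(y) = C·Jy/(1 + ‖y‖²) → 0` at infinity at the scale-invariant rate `1/‖y‖`, and nonzero. So even after
the far-field narrowing (and even inside Pineau–Vicol's decay class) a proof of the open core must consume the
KNSS gauge, and without it there is no small-constant gap (contrast `Negative.SmallConstantGap`). Nothing here
asserts a route statement or closes an item.
-/

noncomputable section

set_option linter.dupNamespace false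

namespace Summit.NavierStokesRegularity.NavierStokesRegularity.Theorems.SymmetricLiouville.Negative

open Literature.Analysis.FluidPDE MeasureTheory Set Function Filter
open scoped RealInnerProductSpace Topology

local notation "E3" => EuclideanSpace ℝ (Fin 3)

/-! ## Coordinates of `J` -/

/-- `(Jx)₀ = −x₁`. -/
theorem rotJ_apply_zero (x : E3) : rotJ x 0 = -x 1 := by
  simp [rotJ_apply]

/-- `(Jx)₁ = x₀`. -/
theorem rotJ_apply_one (x : E3) : rotJ x 1 = x 0 := by
  simp [rotJ_apply]

/-- `(Jx)₂ = 0`. -/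
theorem rotJ_apply_two (x : E3) : rotJ x 2 = 0 := by
  simp [rotJ_apply]

/-- `‖x‖² = x₀² + x₁² + x₂²` on `ℝ³`. -/
private theorem norm_sq_eq_three (x : E3) : ‖x‖ ^ 2 = x 0 ^ 2 + x 1 ^ 2 + x 2 ^ 2 := by
  rw [EuclideanSpace.real_norm_sq_eq, Fin.sum_univ_three]

/-- `‖Jx‖² = x₀² + x₁²`. -/
theorem norm_rotJ_sq (x : E3) : ‖rotJ x‖ ^ 2 = x 0 ^ 2 + x 1 ^ 2 := by
  rw [norm_sq_eq_three, rotJ_apply_zero, rotJ_apply_one, rotJ_apply_two]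
  ring

/-- `‖Jx‖ ≤ ‖x‖`. -/
theorem norm_rotJ_le (x : E3) : ‖rotJ x‖ ≤ ‖x‖ := by
  refine (sq_le_sq₀ (norm_nonneg _) (norm_nonneg _)).1 ?_
  rw [norm_rotJ_sq, norm_sq_eq_three]
  nlinarith [sq_nonneg (x 2)]

/-- `J` is skew in the two-argument form: `⟪x, Jx⟫ = 0`. -/
theorem inner_self_rotJ (x : E3) : ⟪x, rotJ x⟫ = 0 := by
  rw [real_inner_comm]
  exact inner_rotJ_self x

/-! ## The decaying swirl `Jx/(‖x‖² − t)` -/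

/-- The decaying self-similar swirl `u(t, x) = Jx/(‖x‖² − t)`. -/
def swirlField : ℝ → E3 → E3 := fun t x => (‖x‖ ^ 2 - t)⁻¹ • rotJ x

/-- Unfolding the swirl. -/
theorem swirlField_apply (t : ℝ) (x : E3) : swirlField t x = (‖x‖ ^ 2 - t)⁻¹ • rotJ x := rfl

/-- The denominator is positive for `t < 0`. -/
theorem normSq_sub_pos {t : ℝ} (ht : t < 0) (x : E3) : 0 < ‖x‖ ^ 2 - t := by
  have := sq_nonneg ‖x‖
  linarith

/-- It is jointly smooth on `t < 0`. -/
theorem swirlField_smooth : ContDiffOn ℝ (⊤ : ℕ∞) (uncurry swirlField) (Iio 0 ×ˢ univ) := by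
  rintro ⟨t, x⟩ ⟨ht, -⟩
  simp only [mem_Iio] at ht
  have hD : ContDiffAt ℝ ((⊤ : ℕ∞) : WithTop ℕ∞) (fun w : ℝ × E3 => ‖w.2‖ ^ 2 - w.1) (t, x) :=
    ((contDiff_norm_sq ℝ).comp contDiff_snd).contDiffAt.sub contDiffAt_fst
  have hne : ‖(t, x).2‖ ^ 2 - (t, x).1 ≠ 0 := (normSq_sub_pos ht x).ne'
  have hJ : ContDiffAt ℝ ((⊤ : ℕ∞) : WithTop ℕ∞) (fun w : ℝ × E3 => rotJ w.2) (t, x) :=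
    (rotJ.contDiff.comp contDiff_snd).contDiffAt
  have h : ContDiffAt ℝ ((⊤ : ℕ∞) : WithTop ℕ∞)
      (fun w : ℝ × E3 => (‖w.2‖ ^ 2 - w.1)⁻¹ • rotJ w.2) (t, x) := (hD.inv hne).smul hJ
  exact h.contDiffWithinAt

/-- The norm bound `‖u(t,x)‖ ≤ ‖x‖/(‖x‖² − t)`. -/
theorem norm_swirlField_le {t : ℝ} (ht : t < 0) (x : E3) :
    ‖swirlField t x‖ ≤ ‖x‖ / (‖x‖ ^ 2 - t) := by
  have hD := normSq_sub_pos ht x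
  rw [swirlField_apply, norm_smul, norm_inv, Real.norm_of_nonneg hD.le, inv_mul_eq_div]
  exact div_le_div_of_nonneg_right (norm_rotJ_le x) hD.le

/-- It is Type-I in time with constant `1`: `‖x‖/(‖x‖² − t) ≤ 1/√(−t)`. -/
theorem swirlField_typeI : HasTypeITimeDecay 1 swirlField := by
  intro t ht x
  have hD := normSq_sub_pos ht x
  have hs : 0 < Real.sqrt (-t) := Real.sqrt_pos.2 (by linarith)
  have hs2 : Real.sqrt (-t) ^ 2 = -t := Real.sq_sqrt (by linarith)
  refine (norm_swirlField_le ht x).trans ?_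
  rw [div_le_div_iff₀ hD hs, one_mul]
  nlinarith [sq_nonneg (‖x‖ - Real.sqrt (-t)), norm_nonneg x]

/-- It is even Type-I in space–time (Pineau–Vicol's class (1.10)) with constant `2`:
`‖u(t,x)‖ ≤ 2/(‖x‖ + √(−t))`. -/
theorem swirlField_typeI_spaceTime : HasTypeIDecay 2 swirlField := by
  intro t ht x
  have hD := normSq_sub_pos ht x
  have hs : 0 < Real.sqrt (-t) := Real.sqrt_pos.2 (by linarith)
  have hs2 : Real.sqrt (-t) ^ 2 = -t := Real.sq_sqrt (by linarith)
  have hden : 0 < ‖x‖ + Real.sqrt (-t) := add_pos_of_nonneg_of_pos (norm_nonneg _) hs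
  refine (norm_swirlField_le ht x).trans ?_
  rw [div_le_div_iff₀ hD hden]
  nlinarith [sq_nonneg (‖x‖ - Real.sqrt (-t)), norm_nonneg x, sq_nonneg ‖x‖]

/-- FAR-FIELD VANISHING at the scale-invariant rate: `√(−t)‖u(t,x)‖ ≤ ε` once `‖x‖ ≥ ε⁻¹√(−t)`
(the profile `Jy/(1 + ‖y‖²)` is `≤ 1/‖y‖`). -/
theorem swirlField_farField :
    ∀ ε > 0, ∃ R : ℝ, ∀ t < 0, ∀ x : E3, R * Real.sqrt (-t) ≤ ‖x‖ →
      Real.sqrt (-t) * ‖swirlField t x‖ ≤ ε := by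
  intro ε hε
  refine ⟨ε⁻¹, fun t ht x hx => ?_⟩
  have hs : 0 < Real.sqrt (-t) := Real.sqrt_pos.2 (by linarith)
  have hxpos : 0 < ‖x‖ := lt_of_lt_of_le (mul_pos (inv_pos.2 hε) hs) hx
  have hD := normSq_sub_pos ht x
  have h1 : ‖swirlField t x‖ ≤ ‖x‖⁻¹ := by
    refine (norm_swirlField_le ht x).trans ?_
    rw [div_le_iff₀ hD]
    have e : ‖x‖⁻¹ * (‖x‖ ^ 2 - t) = ‖x‖ + ‖x‖⁻¹ * (-t) := by
      field_simp
      ring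
    rw [e]
    have : 0 ≤ ‖x‖⁻¹ * (-t) := mul_nonneg (inv_nonneg.2 hxpos.le) (by linarith)
    linarith
  calc Real.sqrt (-t) * ‖swirlField t x‖ ≤ Real.sqrt (-t) * ‖x‖⁻¹ :=
        mul_le_mul_of_nonneg_left h1 hs.le
    _ ≤ ε := by
        rw [mul_inv_le_iff₀ hxpos]
        calc Real.sqrt (-t) = ε * (ε⁻¹ * Real.sqrt (-t)) := by field_simp
          _ ≤ ε * ‖x‖ := mul_le_mul_of_nonneg_left hx hε.le

/-- The swirl does not vanish: `u(−1, f₀) = ½ e₁`. -/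
theorem swirlField_ne_zero : swirlField (-1) f0 ≠ 0 := by
  rw [swirlField_apply, rotJ_f0, norm_f0]
  norm_num
  exact e1_ne_zero

/-! ## Derivatives and the rotated-scaling clause with `A = J` -/

/-- Spatial derivative of a slice, applied to a vector:
`D(u(t,·))(x) h = (‖x‖² − t)⁻¹ Jh − (2⟪x,h⟫/(‖x‖² − t)²) Jx`. -/
theorem hasFDerivAt_swirlField {t : ℝ} (ht : t < 0) (x : E3) :
    HasFDerivAt (swirlField t)
      ((‖x‖ ^ 2 - t)⁻¹ • (rotJ : E3 →L[ℝ] E3) +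
        ((ContinuousLinearMap.toSpanSingleton ℝ (-((‖x‖ ^ 2 - t) ^ 2)⁻¹)).comp
          (2 • innerSL ℝ x)).smulRight (rotJ x)) x := by
  have hne : ‖x‖ ^ 2 - t ≠ 0 := (normSq_sub_pos ht x).ne'
  have hD : HasFDerivAt (fun y : E3 => ‖y‖ ^ 2 - t) (2 • innerSL ℝ x) x :=
    (hasStrictFDerivAt_norm_sq x).hasFDerivAt.sub_const t
  have hinv : HasFDerivAt (fun y : E3 => (‖y‖ ^ 2 - t)⁻¹)
      ((ContinuousLinearMap.toSpanSingleton ℝ (-((‖x‖ ^ 2 - t) ^ 2)⁻¹)).comp (2 • innerSL ℝ x)) x :=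
    (hasFDerivAt_inv hne).comp x hD
  exact hinv.smul rotJ.hasFDerivAt

/-- The applied form of the spatial derivative. -/
theorem fderiv_swirlField_apply {t : ℝ} (ht : t < 0) (x h : E3) :
    fderiv ℝ (swirlField t) x h =
      (‖x‖ ^ 2 - t)⁻¹ • rotJ h + (2 * ⟪x, h⟫ * -((‖x‖ ^ 2 - t) ^ 2)⁻¹) • rotJ x := by
  rw [(hasFDerivAt_swirlField ht x).fderiv]
  simp only [_root_.add_apply, _root_.smul_apply,
    ContinuousLinearMap.smulRight_apply, ContinuousLinearMap.comp_apply,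
    ContinuousLinearMap.toSpanSingleton_apply, innerSL_apply_apply, smul_eq_mul, nsmul_eq_mul,
    Nat.cast_ofNat]

/-- Time derivative through a fixed point: `∂ₜu(t,x) = (‖x‖² − t)⁻² Jx`. -/
theorem hasDerivAt_swirlField {t : ℝ} (ht : t < 0) (x : E3) :
    HasDerivAt (fun s => swirlField s x) ((-(0 - 1) / (‖x‖ ^ 2 - t) ^ 2) • rotJ x) t := by
  have hne : ‖x‖ ^ 2 - t ≠ 0 := (normSq_sub_pos ht x).ne'
  have hc : HasDerivAt (fun s : ℝ => ‖x‖ ^ 2 - s) (0 - 1) t :=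
    (hasDerivAt_const t (‖x‖ ^ 2)).sub (hasDerivAt_id t)
  have hinv : HasDerivAt (fun s : ℝ => (‖x‖ ^ 2 - s)⁻¹) (-(0 - 1) / (‖x‖ ^ 2 - t) ^ 2) t :=
    hc.inv hne
  exact hinv.smul_const (rotJ x)

/-- **The swirl is rotated self-similar with rate `J`**: it satisfies the clause of the open core,
`∇u·(x + Jx) + u + 2t∂ₜu − Ju = 0` (it is backward self-similar, `∇u·x + u + 2t∂ₜu = 0`, and
axisymmetric about the `x₂`-axis, `∇u·(Jx) − Ju = 0`). -/
theorem swirlField_clause {t : ℝ} (ht : t < 0) (x : E3) :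
    fderiv ℝ (swirlField t) x (x + rotJ x) + swirlField t x +
      (2 * t) • timeDeriv swirlField t x - rotJ (swirlField t x) = 0 := by
  have hD : ‖x‖ ^ 2 - t ≠ 0 := (normSq_sub_pos ht x).ne'
  rw [timeDeriv_apply, (hasDerivAt_swirlField ht x).deriv, fderiv_swirlField_apply ht, swirlField_apply,
    map_add, map_smul, inner_add_right, real_inner_self_eq_norm_sq, inner_self_rotJ, add_zero]
  simp only [smul_add, smul_smul]
  have key : (‖x‖ ^ 2 - t)⁻¹ + 2 * ‖x‖ ^ 2 * -((‖x‖ ^ 2 - t) ^ 2)⁻¹ + (‖x‖ ^ 2 - t)⁻¹ +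
      2 * t * (-(0 - 1) / (‖x‖ ^ 2 - t) ^ 2) = 0 := by
    field_simp
    ring
  have e : (‖x‖ ^ 2 - t)⁻¹ • rotJ x + (‖x‖ ^ 2 - t)⁻¹ • rotJ (rotJ x) +
      (2 * ‖x‖ ^ 2 * -((‖x‖ ^ 2 - t) ^ 2)⁻¹) • rotJ x + (‖x‖ ^ 2 - t)⁻¹ • rotJ x +
      (2 * t * (-(0 - 1) / (‖x‖ ^ 2 - t) ^ 2)) • rotJ x - (‖x‖ ^ 2 - t)⁻¹ • rotJ (rotJ x) =
      ((‖x‖ ^ 2 - t)⁻¹ + 2 * ‖x‖ ^ 2 * -((‖x‖ ^ 2 - t) ^ 2)⁻¹ + (‖x‖ ^ 2 - t)⁻¹ +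
        2 * t * (-(0 - 1) / (‖x‖ ^ 2 - t) ^ 2)) • rotJ x := by
    module
  rw [e, key, zero_smul]

/-- **The swirl is divergence free** on every slice `t < 0`: `div u = (‖x‖² − t)⁻¹ tr J −
2(‖x‖² − t)⁻² ⟪x, Jx⟫ = 0`. -/
theorem swirlField_divFree {t : ℝ} (ht : t < 0) : VectorCalculus.IsDivFree (swirlField t) := by
  intro y
  set b := EuclideanSpace.basisFun (Fin 3) ℝ with hb
  rw [divergence_eq_sum_inner_fderiv b]
  simp_rw [fderiv_swirlField_apply ht, inner_add_right, real_inner_smul_right]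
  have hdiag : ∀ i, ⟪b i, rotJ (b i)⟫ = 0 := fun i => inner_self_rotJ (b i)
  simp_rw [hdiag, mul_zero, zero_add]
  have hpar : ∑ i, ⟪y, b i⟫ * ⟪b i, rotJ y⟫ = ⟪y, rotJ y⟫ := b.sum_inner_mul_inner y (rotJ y)
  calc ∑ i, 2 * ⟪y, b i⟫ * -((‖y‖ ^ 2 - t) ^ 2)⁻¹ * ⟪b i, rotJ y⟫
      = 2 * -((‖y‖ ^ 2 - t) ^ 2)⁻¹ * ∑ i, ⟪y, b i⟫ * ⟪b i, rotJ y⟫ := by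
        rw [Finset.mul_sum]
        refine Finset.sum_congr rfl fun i _ => ?_
        ring
    _ = 0 := by rw [hpar, inner_self_rotJ, mul_zero]

/-! ## Every positive Type-I constant: the scaled swirls `κ • u` -/

/-- The scaled swirl `κ Jx/(‖x‖² − t)`. -/
def swirlScaled (κ : ℝ) : ℝ → E3 → E3 := fun t x => κ • swirlField t x

/-- Unfolding. -/
theorem swirlScaled_apply (κ t : ℝ) (x : E3) : swirlScaled κ t x = κ • swirlField t x := rfl

/-- Smoothness of the scaled swirl. -/
theorem swirlScaled_smooth (κ : ℝ) : ContDiffOn ℝ (⊤ : ℕ∞) (uncurry (swirlScaled κ)) (Iio 0 ×ˢ univ) :=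
  swirlField_smooth.const_smul κ

/-- The scaled swirl is divergence free (the divergence is linear). -/
theorem swirlScaled_divFree (κ : ℝ) {t : ℝ} (ht : t < 0) : VectorCalculus.IsDivFree (swirlScaled κ t) := by
  intro y
  have hd : DifferentiableAt ℝ (swirlField t) y := (hasFDerivAt_swirlField ht y).differentiableAt
  have h0 := swirlField_divFree ht y
  unfold VectorCalculus.divergence at h0 ⊢
  rw [show swirlScaled κ t = fun x => κ • swirlField t x from rfl, fderiv_fun_const_smul hd κ,
    ContinuousLinearMap.toLinearMap_smul, LinearMap.map_smul, h0, smul_zero]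

/-- Type-I in time with constant `κ` (`κ ≥ 0`). -/
theorem swirlScaled_typeI {κ : ℝ} (hκ : 0 ≤ κ) : HasTypeITimeDecay κ (swirlScaled κ) := by
  intro t ht x
  rw [swirlScaled_apply, norm_smul, Real.norm_of_nonneg hκ, div_eq_mul_one_div]
  exact mul_le_mul_of_nonneg_left (swirlField_typeI t ht x) hκ

/-- Type-I in space–time with constant `2κ` (`κ ≥ 0`). -/
theorem swirlScaled_typeI_spaceTime {κ : ℝ} (hκ : 0 ≤ κ) : HasTypeIDecay (2 * κ) (swirlScaled κ) := by
  intro t ht x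
  rw [swirlScaled_apply, norm_smul, Real.norm_of_nonneg hκ, mul_comm 2 κ, mul_div_assoc]
  exact mul_le_mul_of_nonneg_left (swirlField_typeI_spaceTime t ht x) hκ

/-- Far-field vanishing of the scaled swirl (`κ > 0`). -/
theorem swirlScaled_farField {κ : ℝ} (hκ : 0 < κ) :
    ∀ ε > 0, ∃ R : ℝ, ∀ t < 0, ∀ x : E3, R * Real.sqrt (-t) ≤ ‖x‖ →
      Real.sqrt (-t) * ‖swirlScaled κ t x‖ ≤ ε := by
  intro ε hε
  obtain ⟨R, hR⟩ := swirlField_farField (ε / κ) (div_pos hε hκ)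
  refine ⟨R, fun t ht x hx => ?_⟩
  have h := hR t ht x hx
  rw [swirlScaled_apply, norm_smul, Real.norm_of_nonneg hκ.le, mul_left_comm]
  rwa [le_div_iff₀' hκ] at h

/-- The scaled swirl satisfies the rotated-scaling clause with `A = J` (the clause is linear in `u`). -/
theorem swirlScaled_clause (κ : ℝ) {t : ℝ} (ht : t < 0) (x : E3) :
    fderiv ℝ (swirlScaled κ t) x (x + rotJ x) + swirlScaled κ t x +
      (2 * t) • timeDeriv (swirlScaled κ) t x - rotJ (swirlScaled κ t x) = 0 := by
  have hd : DifferentiableAt ℝ (swirlField t) x := (hasFDerivAt_swirlField ht x).differentiableAt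
  have hdt : DifferentiableAt ℝ (fun s => swirlField s x) t := (hasDerivAt_swirlField ht x).differentiableAt
  have h1 : fderiv ℝ (swirlScaled κ t) x = κ • fderiv ℝ (swirlField t) x := by
    rw [show swirlScaled κ t = fun y => κ • swirlField t y from rfl, fderiv_fun_const_smul hd κ]
  have h2 : timeDeriv (swirlScaled κ) t x = κ • timeDeriv swirlField t x := by
    simp only [timeDeriv_apply, swirlScaled_apply]
    exact deriv_fun_const_smul κ hdt
  have key := congrArg (fun w => κ • w) (swirlField_clause ht x)
  simp only [smul_zero, smul_add, smul_sub] at key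
  rw [h1, h2, swirlScaled_apply, _root_.smul_apply, map_smul, smul_comm (2 * t) κ]
  exact key

/-- The scaled swirl is nonzero for `κ ≠ 0`. -/
theorem swirlScaled_ne_zero {κ : ℝ} (hκ : κ ≠ 0) : swirlScaled κ (-1) f0 ≠ 0 := by
  rw [swirlScaled_apply]
  exact smul_ne_zero hκ swirlField_ne_zero

/-! ## The mutant and its refutation -/

/-- The narrowed open core `stub_rssLiouvilleOfFarField` of line `blowdown-kills-pitch` AT A FIXED TYPE-I
CONSTANT `C` (rotated self-similar element, `A ≠ 0` skew, profile vanishing at infinity at the scale-invariant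
rate ⇒ `u = 0`) with the Oseen integral equation DROPPED from the class (smoothness, divergence-freeness and
the Type-I rate kept; the space–time Type-I bound of Pineau–Vicol's class (1.10) even ADDED, with constant `2C`). -/
def RssLiouvilleOfFarFieldWithoutMildAt (C : ℝ) : Prop :=
  ∀ u : ℝ → E3 → E3,
    ContDiffOn ℝ (⊤ : ℕ∞) (uncurry u) (Iio 0 ×ˢ univ) → (∀ t < 0, VectorCalculus.IsDivFree (u t)) →
    HasTypeITimeDecay C u → HasTypeIDecay (2 * C) u →
    ∀ A : E3 →L[ℝ] E3, (∀ x, ⟪A x, x⟫ = 0) → A ≠ 0 →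
      (∀ t < 0, ∀ x, fderiv ℝ (u t) x (x + A x) + u t x + (2 * t) • timeDeriv u t x - A (u t x) = 0) →
      (∀ ε > 0, ∃ R : ℝ, ∀ t < 0, ∀ x, R * Real.sqrt (-t) ≤ ‖x‖ → Real.sqrt (-t) * ‖u t x‖ ≤ ε) →
      ∀ t < 0, ∀ x, u t x = 0

/-- The same over all constants (the literal shape of the stub, class hypothesis `IsTypeIAncientMild C u`
unbundled and its mild clause removed). -/
def RssLiouvilleOfFarFieldWithoutMild : Prop :=
  ∀ C : ℝ, RssLiouvilleOfFarFieldWithoutMildAt C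

/-- **The gauge is load-bearing for the narrowed open core at EVERY positive constant** (`A = J ≠ 0`):
without the Oseen integral equation the scaled decaying swirl `C·Jx/(‖x‖² − t)` is smooth, divergence free,
Type-I in time (constant `C`) and in space–time (`2C/(‖x‖ + √(−t))`), rotated self-similar with rate `J`
(indeed self-similar AND axisymmetric), small far from the centre at the scale-invariant rate, and nonzero.
Contrast: WITH the gauge the statement is TRUE for `C ≤ ε₀` by the gap theorem
`Negative.SmallConstantGap.exists_eps_small_vanishes` — so the small-constant regime is exactly what the KNSS-mild
equation buys first; without it there is no gap at all. [folklore] -/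
theorem rssLiouvilleOfFarField_false_without_mild_at {C : ℝ} (hC : 0 < C) :
    ¬ RssLiouvilleOfFarFieldWithoutMildAt C := fun h =>
  swirlScaled_ne_zero hC.ne' (h (swirlScaled C) (swirlScaled_smooth C) (fun _ ht => swirlScaled_divFree C ht)
    (swirlScaled_typeI hC.le) (swirlScaled_typeI_spaceTime hC.le) rotJ inner_rotJ_self rotJ_ne_zero
    (fun _ ht x => swirlScaled_clause C ht x) (swirlScaled_farField hC) (-1) (by norm_num) f0)

/-- **The gauge is load-bearing for the narrowed open core** (all-constants form, witnessed at `C = 1` by the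
decaying swirl `Jx/(‖x‖² − t)`; its profile `U(y) = Jy/(1 + ‖y‖²)` is bounded, decays like `1/‖y‖`, and is not a
Leray profile — the only thing that rules it out is the Navier–Stokes equation in its KNSS-mild form). [folklore] -/
theorem rssLiouvilleOfFarField_false_without_mild : ¬ RssLiouvilleOfFarFieldWithoutMild := fun h =>
  rssLiouvilleOfFarField_false_without_mild_at one_pos (h 1)

end Summit.NavierStokesRegularity.NavierStokesRegularity.Theorems.SymmetricLiouville.Negative

end
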